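import Mathlib
import Summits.Ventures.PercRepro2.Defs
import Summits.Ventures.PercRepro2.Independence
import Summits.Ventures.PercRepro2.Graph
import Summits.Ventures.PercRepro2.Exploration
import Summits.Ventures.PercRepro2.Induced
import Summits.Ventures.PercRepro2.R2PrimeThreeReduction
import Summits.Ventures.PercRepro2.YBridge
import Summits.Ventures.PercRepro2.HCov
import Summits.Ventures.PercRepro2.HubModel
import Summits.Ventures.PercRepro2.HubLaw
import Summits.Ventures.PercRepro2.HubRootLaw
import Summits.Ventures.PercRepro2.HubConn
import Summits.Ventures.PercRepro2.HubBernstein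
import Summits.Ventures.PercRepro2.HubGc

/-!
# Kronecker substitution: the hub table as big-integer arithmetic
(blind cell PercRepro2, typer-1 g8; HUB-LEAN-SCOPE.md (S4), kernel route)

A table `T : (Fin 7 → Bool) → ℤ` on the root-bundle states is encoded as the integer
`kron T = Σ_w T w · KB^{idx4 w}` (`idx4 w = Σᵢ wᵢ 4ⁱ`, `KB = 2^32`).  Because the profile of three
states has base-4 digits `≤ 3`, indices add without carries (`idx4K_prof`), and a product of three
encodings is the encoding of the profile convolution:
`kron T₁ · kron T₂ · kron T₃ = Σ_k coef3 T₁ T₂ T₃ k · KB^{idx4K k}` (`kron_mul_mul`) — the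
degree-3 Bernstein coefficients of `HubBernstein.lean` read off ONE big-integer product, which the
kernel evaluates natively (GMP).  Hence the **Kronecker hub number**
`kronW π₁ π₂ π₃ = Σ_k W_k(π₁, π₂, π₃) · KB^{idx4K k}` (`kronW_eq`) carries the whole hub table
of a pattern triple.  `digits_unique_idx` recovers the table from the number: digit vectors with
entries of absolute value `< 2^31` and equal Kronecker numbers are equal.  `abs_Wtot_le` bounds
the hub table by `38 · 2^21 < 2^27`.
-/

namespace Summit.Ventures.PercRepro2.Hub

section Index

/-- The base-4 index of a state: `Σᵢ wᵢ 4ⁱ`. -/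
def idx4 (w : Fin 7 → Bool) : ℕ := ∑ i, (w i).toNat * 4 ^ (i : ℕ)

/-- The base-4 index of a type vector: `Σᵢ kᵢ 4ⁱ`. -/
def idx4K (k : Fin 7 → Fin 4) : ℕ := ∑ i, (k i : ℕ) * 4 ^ (i : ℕ)

/-- The index of a profile is the sum of the indices of the states (no carries). -/
lemma idx4K_prof (w₁ w₂ w₃ : Fin 7 → Bool) :
    idx4K (prof w₁ w₂ w₃) = idx4 w₁ + idx4 w₂ + idx4 w₃ := by
  simp only [idx4K, idx4, prof_apply, add_mul, Finset.sum_add_distrib]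

/-- Decoding a base-4 index into a type vector. -/
def decode4 (n : ℕ) : Fin 7 → Fin 4 := fun i => ⟨n / 4 ^ (i : ℕ) % 4, Nat.mod_lt _ (by norm_num)⟩

/-- The index, written out. -/
lemma idx4K_eq (k : Fin 7 → Fin 4) : idx4K k =
    k 0 + 4 * k 1 + 16 * k 2 + 64 * k 3 + 256 * k 4 + 1024 * k 5 + 4096 * k 6 := by
  simp only [idx4K, Fin.sum_univ_seven]
  norm_num
  ring

set_option maxRecDepth 8000 in
/-- Decoding inverts the index. -/
lemma decode4_idx4K (k : Fin 7 → Fin 4) : decode4 (idx4K k) = k := by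
  have h0 := (k 0).isLt
  have h1 := (k 1).isLt
  have h2 := (k 2).isLt
  have h3 := (k 3).isLt
  have h4 := (k 4).isLt
  have h5 := (k 5).isLt
  have h6 := (k 6).isLt
  have e := idx4K_eq k
  funext i
  apply Fin.ext
  fin_cases i
  · show idx4K k / 1 % 4 = (k 0 : ℕ)
    omega
  · show idx4K k / 4 % 4 = (k 1 : ℕ)
    omega
  · show idx4K k / 16 % 4 = (k 2 : ℕ)
    omega
  · show idx4K k / 64 % 4 = (k 3 : ℕ)
    omega
  · show idx4K k / 256 % 4 = (k 4 : ℕ)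
    omega
  · show idx4K k / 1024 % 4 = (k 5 : ℕ)
    omega
  · show idx4K k / 4096 % 4 = (k 6 : ℕ)
    omega

/-- The index of a type vector is below `4^7`. -/
lemma idx4K_lt (k : Fin 7 → Fin 4) : idx4K k < 16384 := by
  have h0 := (k 0).isLt
  have h1 := (k 1).isLt
  have h2 := (k 2).isLt
  have h3 := (k 3).isLt
  have h4 := (k 4).isLt
  have h5 := (k 5).isLt
  have h6 := (k 6).isLt
  rw [idx4K_eq]
  omega

set_option maxRecDepth 8000 in
/-- The index of a decoded number below `4^7` is the number. -/
lemma idx4K_decode4 {n : ℕ} (hn : n < 16384) : idx4K (decode4 n) = n := by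
  rw [idx4K_eq]
  show n / 1 % 4 + 4 * (n / 4 % 4) + 16 * (n / 16 % 4) + 64 * (n / 64 % 4) + 256 * (n / 256 % 4) +
    1024 * (n / 1024 % 4) + 4096 * (n / 4096 % 4) = n
  omega

/-- The index is injective. -/
lemma idx4K_injective : Function.Injective idx4K := fun k k' h => by
  rw [← decode4_idx4K k, ← decode4_idx4K k', h]

end Index

section Kron

/-- The Kronecker base: `2^32`. -/
def KB : ℤ := 2 ^ 32

/-- The Kronecker encoding of a table on the states. -/
def kron (T : (Fin 7 → Bool) → ℤ) : ℤ := ∑ w, T w * KB ^ idx4 w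

/-- A product of three encodings as a triple sum. -/
lemma kron_mul_mul_eq_sum (T₁ T₂ T₃ : (Fin 7 → Bool) → ℤ) :
    kron T₁ * kron T₂ * kron T₃ =
      ∑ t : (Fin 7 → Bool) × (Fin 7 → Bool) × (Fin 7 → Bool),
        T₁ t.1 * T₂ t.2.1 * T₃ t.2.2 * KB ^ idx4K (prof t.1 t.2.1 t.2.2) := by
  unfold kron
  rw [sum_mul_sum_mul_sum]
  simp only [Fintype.sum_prod_type]
  refine Finset.sum_congr rfl fun a _ => Finset.sum_congr rfl fun b _ =>
    Finset.sum_congr rfl fun c _ => ?_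
  rw [idx4K_prof, pow_add, pow_add]
  ring

set_option maxRecDepth 8000 in
/-- **Kronecker substitution**: a product of three encodings is the encoding of the Bernstein
coefficients `coef3`. -/
theorem kron_mul_mul (T₁ T₂ T₃ : (Fin 7 → Bool) → ℤ) :
    kron T₁ * kron T₂ * kron T₃ = ∑ k, coef3 T₁ T₂ T₃ k * KB ^ idx4K k := by
  rw [kron_mul_mul_eq_sum]
  unfold coef3
  simp only [Finset.sum_mul]
  rw [← Finset.sum_fiberwise Finset.univ
    (fun t : (Fin 7 → Bool) × (Fin 7 → Bool) × (Fin 7 → Bool) => prof t.1 t.2.1 t.2.2)]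
  refine Finset.sum_congr rfl fun k _ => Finset.sum_congr rfl fun t ht => ?_
  rw [Finset.mem_filter] at ht
  rw [ht.2]

/-- The Kronecker encoding of a hub function at an inner pattern. -/
def kronT (Φ : HubFn) (π : Fin 3 → Bool) : ℤ := kron fun w => Φ w π

/-- **The Kronecker hub number** of a pattern triple: the eight products of `GcB`. -/
def kronW (π₁ π₂ π₃ : Fin 3 → Bool) : ℤ :=
  kronT fQ π₁ * kronT fPD π₂ * kronT fEQbo π₃ + kronT fQ π₁ * kronT fDo π₂ * kronT fEQb3 π₃ -
    kronT fQ π₁ * kronT fPD π₂ * kronT fEQb3o π₃ + kronT fgap π₁ * kronT fPD π₂ * kronT fEQo π₃ +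
    kronT fgap π₁ * kronT fDo π₂ * kronT fEQ3 π₃ - kronT fgap π₁ * kronT fPD π₂ * kronT fEQ3o π₃ +
    kronT fQ π₁ * kronT fDo π₂ * kronT fPDb π₃ - kronT fQ π₁ * kronT fPD π₂ * kronT fPDbo π₃

set_option maxRecDepth 8000 in
/-- **The Kronecker hub number carries the hub table**: `kronW = Σ_k W_k · KB^{idx4K k}`. -/
theorem kronW_eq (π₁ π₂ π₃ : Fin 3 → Bool) :
    kronW π₁ π₂ π₃ = ∑ k, Wtot k π₁ π₂ π₃ * KB ^ idx4K k := by
  unfold kronW kronT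
  simp only [kron_mul_mul, ← Finset.sum_add_distrib, ← Finset.sum_sub_distrib]
  refine Finset.sum_congr rfl fun k _ => ?_
  unfold Wtot wZ coef3
  simp only [Pi.add_apply, Pi.sub_apply]
  ring

end Kron

section Digits

/-- **Digit uniqueness**: two digit vectors with digits in `[0, B)` and the same value agree. -/
theorem digits_unique (B : ℤ) (hB : 0 < B) : ∀ (N : ℕ) (a b : ℕ → ℤ),
    (∀ n < N, 0 ≤ a n ∧ a n < B) → (∀ n < N, 0 ≤ b n ∧ b n < B) →
    ∑ n ∈ Finset.range N, a n * B ^ n = ∑ n ∈ Finset.range N, b n * B ^ n → ∀ n < N, a n = b n := by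
  intro N
  induction N with
  | zero => intro a b _ _ _ n hn; exact absurd hn (Nat.not_lt_zero n)
  | succ N ih =>
    intro a b ha hb h n hn
    have e : ∀ c : ℕ → ℤ, ∑ n ∈ Finset.range (N + 1), c n * B ^ n =
        c 0 + B * ∑ n ∈ Finset.range N, c (n + 1) * B ^ n := by
      intro c
      rw [Finset.sum_range_succ', Finset.mul_sum]
      simp only [pow_zero, mul_one, pow_succ]
      rw [add_comm]
      congr 1
      exact Finset.sum_congr rfl fun n _ => by ring
    rw [e a, e b] at h
    have ha0 := ha 0 (Nat.succ_pos N)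
    have hb0 := hb 0 (Nat.succ_pos N)
    -- the two digit-0 values agree: both are the remainder modulo `B`
    have hmod : ∀ (c : ℤ) (X : ℤ), 0 ≤ c → c < B → (c + B * X) % B = c := by
      intro c X hc hcB
      rw [Int.add_mul_emod_self_left, Int.emod_eq_of_lt hc hcB]
    have h0 : a 0 = b 0 := by
      have := congrArg (· % B) h
      rwa [hmod _ _ ha0.1 ha0.2, hmod _ _ hb0.1 hb0.2] at this
    have htail : ∑ n ∈ Finset.range N, a (n + 1) * B ^ n =
        ∑ n ∈ Finset.range N, b (n + 1) * B ^ n := by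
      rw [h0] at h
      have := add_left_cancel h
      exact mul_left_cancel₀ hB.ne' this
    rcases n with _ | n
    · exact h0
    · exact ih (fun n => a (n + 1)) (fun n => b (n + 1)) (fun n hn => ha (n + 1) (by omega))
        (fun n hn => hb (n + 1) (by omega)) htail n (by omega)

/-- **Balanced digit uniqueness**: digit vectors with entries of absolute value `< H` and the
same value in base `2H` agree. -/
theorem digits_unique_balanced (H : ℤ) (hH : 0 < H) (N : ℕ) (a b : ℕ → ℤ)
    (ha : ∀ n < N, |a n| < H) (hb : ∀ n < N, |b n| < H)
    (h : ∑ n ∈ Finset.range N, a n * (2 * H) ^ n = ∑ n ∈ Finset.range N, b n * (2 * H) ^ n) :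
    ∀ n < N, a n = b n := by
  have key := digits_unique (2 * H) (by positivity) N (fun n => a n + H) (fun n => b n + H)
    (fun n hn => by have := abs_lt.1 (ha n hn); constructor <;> linarith)
    (fun n hn => by have := abs_lt.1 (hb n hn); constructor <;> linarith)
    (by simp only [add_mul, Finset.sum_add_distrib, h])
  intro n hn
  have := key n hn
  simpa using this

/-- **Digit uniqueness over type vectors**: functions on the type vectors with values of
absolute value `< 2^31` and equal Kronecker numbers are equal. -/
theorem digits_unique_idx (a b : (Fin 7 → Fin 4) → ℤ) (ha : ∀ k, |a k| < 2 ^ 31)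
    (hb : ∀ k, |b k| < 2 ^ 31)
    (h : ∑ k, a k * KB ^ idx4K k = ∑ k, b k * KB ^ idx4K k) : a = b := by
  classical
  -- transport to digit vectors on `range 16384`
  let a' : ℕ → ℤ := fun n => if n < 16384 then a (decode4 n) else 0
  let b' : ℕ → ℤ := fun n => if n < 16384 then b (decode4 n) else 0
  have tr : ∀ c : (Fin 7 → Fin 4) → ℤ,
      ∑ k, c k * KB ^ idx4K k =
        ∑ n ∈ Finset.range 16384, (if n < 16384 then c (decode4 n) else 0) * KB ^ n := by
    intro c
    refine Finset.sum_nbij' idx4K decode4 (fun k _ => ?_) (fun n hn => Finset.mem_univ _)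
      (fun k _ => decode4_idx4K k) (fun n hn => ?_) (fun k _ => ?_)
    · exact Finset.mem_range.2 (idx4K_lt k)
    · exact idx4K_decode4 (Finset.mem_range.1 hn)
    · rw [if_pos (idx4K_lt k), decode4_idx4K]
  have hKB : KB = 2 * 2 ^ 31 := by norm_num [KB]
  rw [tr a, tr b, hKB] at h
  have key := digits_unique_balanced (2 ^ 31) (by positivity) 16384 a' b'
    (fun n hn => by simp only [a', if_pos hn]; exact ha _)
    (fun n hn => by simp only [b', if_pos hn]; exact hb _) h
  funext k
  have := key (idx4K k) (idx4K_lt k)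
  simp only [a', b', if_pos (idx4K_lt k), decode4_idx4K] at this
  exact this

end Digits

section Bounds

/-- An indicator lies in `[0, 1]`. -/
lemma ind_mem (Ψ : HubEvt) (w : Fin 7 → Bool) (π : Fin 3 → Bool) :
    0 ≤ ind Ψ w π ∧ ind Ψ w π ≤ 1 := by
  unfold ind
  split_ifs <;> norm_num

/-- Bounds of the twelve hub functions (crude: the number of indicators). -/
lemma abs_hub_le (w : Fin 7 → Bool) (π : Fin 3 → Bool) :
    |fQ w π| ≤ 1 ∧ |fPD w π| ≤ 1 ∧ |fDo w π| ≤ 2 ∧ |fgap w π| ≤ 1 ∧ |fEQbo w π| ≤ 4 ∧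
      |fEQb3 w π| ≤ 4 ∧ |fEQb3o w π| ≤ 8 ∧ |fEQo w π| ≤ 2 ∧ |fEQ3 w π| ≤ 2 ∧ |fEQ3o w π| ≤ 4 ∧
      |fPDb w π| ≤ 2 ∧ |fPDbo w π| ≤ 4 := by
  have h := fun Ψ => ind_mem Ψ w π
  unfold fQ fPD fDo fgap fEQbo fEQb3 fEQb3o fEQo fEQ3 fEQ3o fPDb fPDbo
  simp only [Pi.add_apply, Pi.sub_apply]
  refine ⟨?_, ?_, ?_, ?_, ?_, ?_, ?_, ?_, ?_, ?_, ?_, ?_⟩ <;>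
    (rw [abs_le]; constructor <;> linarith [h hQ, h hPD, h (hand hPD o1), h (hand hPD o2), h b2,
      h b1, h (hand hQ (hand o1 b1)), h (hand hQ (hand o2 b2)), h (hand hQ (hand o2 b1)),
      h (hand hQ (hand o1 b2)), h (hand hT' b1), h (hand hT b2), h (hand hT b1), h (hand hT' b2),
      h (hand hT' (hand o1 b1)), h (hand hT' (hand o2 b1)), h (hand hT (hand o1 b2)),
      h (hand hT (hand o2 b2)), h (hand hT (hand o1 b1)), h (hand hT (hand o2 b1)),
      h (hand hT' (hand o1 b2)), h (hand hT' (hand o2 b2)), h (hand hQ o1), h (hand hQ o2), h hT',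
      h hT, h (hand hT' o1), h (hand hT' o2), h (hand hT o1), h (hand hT o2), h (hand hPD b1),
      h (hand hPD b2), h (hand hPD (hand o1 b1)), h (hand hPD (hand o2 b1)),
      h (hand hPD (hand o1 b2)), h (hand hPD (hand o2 b2))])

/-- The number of state triples is `2^21`. -/
lemma card_triples :
    Fintype.card ((Fin 7 → Bool) × (Fin 7 → Bool) × (Fin 7 → Bool)) = 2097152 := by
  simp [Fintype.card_prod, Fintype.card_bool, Fintype.card_fin]

/-- A hub table of three bounded hub functions is bounded by the product of the bounds times the
number of triples. -/
lemma abs_wZ_le {Φ₁ Φ₂ Φ₃ : HubFn} {c₁ c₂ c₃ : ℤ} (h₁ : ∀ w π, |Φ₁ w π| ≤ c₁)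
    (h₂ : ∀ w π, |Φ₂ w π| ≤ c₂) (h₃ : ∀ w π, |Φ₃ w π| ≤ c₃) (k : Fin 7 → Fin 4)
    (π₁ π₂ π₃ : Fin 3 → Bool) : |wZ Φ₁ Φ₂ Φ₃ k π₁ π₂ π₃| ≤ c₁ * c₂ * c₃ * 2097152 := by
  have hc₁ : 0 ≤ c₁ := (abs_nonneg _).trans (h₁ (fun _ => false) π₁)
  have hc₂ : 0 ≤ c₂ := (abs_nonneg _).trans (h₂ (fun _ => false) π₂)
  unfold wZ
  refine (Finset.abs_sum_le_sum_abs _ _).trans ?_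
  have hterm : ∀ t ∈ (Finset.univ : Finset ((Fin 7 → Bool) × (Fin 7 → Bool) × (Fin 7 → Bool))).filter
      (fun t => prof t.1 t.2.1 t.2.2 = k),
      |Φ₁ t.1 π₁ * Φ₂ t.2.1 π₂ * Φ₃ t.2.2 π₃| ≤ c₁ * c₂ * c₃ := by
    intro t _
    rw [abs_mul, abs_mul]
    exact mul_le_mul (mul_le_mul (h₁ _ _) (h₂ _ _) (abs_nonneg _) hc₁) (h₃ _ _) (abs_nonneg _)
      (mul_nonneg hc₁ hc₂)
  refine (Finset.sum_le_card_nsmul _ _ _ hterm).trans ?_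
  rw [nsmul_eq_mul]
  have hcard : ((Finset.univ.filter fun t : (Fin 7 → Bool) × (Fin 7 → Bool) × (Fin 7 → Bool) =>
      prof t.1 t.2.1 t.2.2 = k).card : ℤ) ≤ 2097152 := by
    have := Finset.card_filter_le (Finset.univ : Finset ((Fin 7 → Bool) × (Fin 7 → Bool) × (Fin 7 → Bool)))
      (fun t => prof t.1 t.2.1 t.2.2 = k)
    rw [Finset.card_univ, card_triples] at this
    exact_mod_cast this
  have hc : 0 ≤ c₁ * c₂ * c₃ := mul_nonneg (mul_nonneg hc₁ hc₂)
    ((abs_nonneg _).trans (h₃ (fun _ => false) π₃))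
  calc _ ≤ (2097152 : ℤ) * (c₁ * c₂ * c₃) := mul_le_mul_of_nonneg_right hcard hc
    _ = _ := by ring

/-- **The hub table is bounded**: `|W_k| ≤ 38 · 2^21`. -/
theorem abs_Wtot_le (k : Fin 7 → Fin 4) (π₁ π₂ π₃ : Fin 3 → Bool) :
    |Wtot k π₁ π₂ π₃| ≤ 38 * 2097152 := by
  have hb := fun w π => abs_hub_le w π
  have e1 := abs_wZ_le (fun w π => (hb w π).1) (fun w π => (hb w π).2.1)
    (fun w π => (hb w π).2.2.2.2.1) k π₁ π₂ π₃
  have e2 := abs_wZ_le (fun w π => (hb w π).1) (fun w π => (hb w π).2.2.1)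
    (fun w π => (hb w π).2.2.2.2.2.1) k π₁ π₂ π₃
  have e3 := abs_wZ_le (fun w π => (hb w π).1) (fun w π => (hb w π).2.1)
    (fun w π => (hb w π).2.2.2.2.2.2.1) k π₁ π₂ π₃
  have e4 := abs_wZ_le (fun w π => (hb w π).2.2.2.1) (fun w π => (hb w π).2.1)
    (fun w π => (hb w π).2.2.2.2.2.2.2.1) k π₁ π₂ π₃
  have e5 := abs_wZ_le (fun w π => (hb w π).2.2.2.1) (fun w π => (hb w π).2.2.1)
    (fun w π => (hb w π).2.2.2.2.2.2.2.2.1) k π₁ π₂ π₃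
  have e6 := abs_wZ_le (fun w π => (hb w π).2.2.2.1) (fun w π => (hb w π).2.1)
    (fun w π => (hb w π).2.2.2.2.2.2.2.2.2.1) k π₁ π₂ π₃
  have e7 := abs_wZ_le (fun w π => (hb w π).1) (fun w π => (hb w π).2.2.1)
    (fun w π => (hb w π).2.2.2.2.2.2.2.2.2.2.1) k π₁ π₂ π₃
  have e8 := abs_wZ_le (fun w π => (hb w π).1) (fun w π => (hb w π).2.1)
    (fun w π => (hb w π).2.2.2.2.2.2.2.2.2.2.2) k π₁ π₂ π₃
  unfold Wtot
  simp only [Pi.add_apply, Pi.sub_apply]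
  rw [abs_le] at e1 e2 e3 e4 e5 e6 e7 e8 ⊢
  constructor <;> linarith

end Bounds

end Summit.Ventures.PercRepro2.Hub
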